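import Literature.Topology.FourManifolds.LongAnnulusShear
import Literature.Topology.FourManifolds.ConcordanceStripTubeGeometry
import Literature.Topology.FourManifolds.SphereChartOrientation
import Mathlib.Analysis.SpecialFunctions.SmoothTransition
import HarnessLib

/-!
# The stereographic chart of a conical concordance is a long annulus

Topic `Literature/Topology/FourManifolds`; step (a) of the proof programme of the Fox–Milnor
fact `Literature.Topology.FourManifolds.Knot.exists_isConnectedSum_isConcordant` (both
concordances are read in one stereographic chart, straightened along a spanning arc
(`LongAnnulus.exists_flat_strip`), band-summed statically and read back). Everything here is
proved; no named fact is introduced.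

A conical concordance `f` (`Knot.IsConicalConcordance K K' f δ`) lives in the shell
`1 ≤ ‖y‖ ≤ 2` of `ℝ⁴` with *radial* levels. If its directions `f / ‖f‖` over `[1, 2]` and the end
knots miss the south pole, **polar–stereographic coordinates**
`y ↦ (ψ (y / ‖y‖), ‖y‖)` (`ψ = KnotsInBall.psi`) turn its lift `annulusLift f` into a long
annulus `A : LongAnnulus η` of `ℝ³ × ℝ` (`LongAnnulusShear.lean`) with end curves
`θ ↦ ψ (K (circlePt θ))`, `θ ↦ ψ (K' (circlePt θ))`
(`IsConicalConcordance.exists_longAnnulus`): the collars are the cones (read with the clamped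
parameter `clamp s ∈ [1/2, 1]` below level `1`, so that they are products for *all* `s ≤ 1 + η`),
the margins come from the width `δ` and from compactness of the middle, injectivity and
immersivity from those of `f` through the smooth left inverse `(z, r) ↦ r • ψ⁻¹ z`
(`unchart`, `unchart_chartF`).

## References

* R. H. Fox, J. W. Milnor, *Singularities of 2-spheres in 4-space and cobordism of knots*, Osaka
  J. Math. 3 (1966), §1. [FoxMilnor1966]
* M. W. Hirsch, *Differential Topology*, GTM 33 (1976), Ch. 1 §1 (stereographic charts).
  [HirschDT1976]

## Design notes

No named facts, no `sorry`; `𝔼 n`, `𝕊 n` are local notation as in `Knots.lean`.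
-/

open scoped Manifold Topology ContDiff RealInnerProductSpace
open Function Set Metric Filter

noncomputable section

namespace Literature.Topology.FourManifolds

/-- Local notation: `𝔼 n` is the model Euclidean space `EuclideanSpace ℝ (Fin n)`. -/
local notation "𝔼 " n:arg => EuclideanSpace ℝ (Fin n)

/-- Local notation: `𝕊 n` is the unit sphere in `EuclideanSpace ℝ (Fin (n + 1))`. -/
local notation "𝕊 " n:arg => (Metric.sphere (0 : EuclideanSpace ℝ (Fin (n + 1))) 1)

attribute [local instance] fact_finrank_euclideanSpace_succ

/-! ### The clamped level parameter -/

namespace LongAnnulusChart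

/-- The **clamped parameter**: `clamp s = s` for `s ≥ 1`, `clamp s = 1` for `s ≤ 1/2`, and
`clamp s ∈ [1/2, 1]` for `s ≤ 1`. [folklore] -/
def clamp (s : ℝ) : ℝ := s + (1 - s) * (1 - Real.smoothTransition (2 * s - 1))

/-- `clamp` is `C^∞`. [folklore] -/
theorem contDiff_clamp : ContDiff ℝ ∞ clamp :=
  contDiff_id.add ((contDiff_const.sub contDiff_id).mul
    (contDiff_const.sub (Real.smoothTransition.contDiff.comp
      ((contDiff_const.mul contDiff_id).sub contDiff_const))))

/-- `clamp s = s` for `s ≥ 1`. [folklore] -/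
theorem clamp_of_one_le {s : ℝ} (hs : 1 ≤ s) : clamp s = s := by
  rw [clamp, Real.smoothTransition.one_of_one_le (by linarith)]; ring

/-- `clamp s = 1` for `s ≤ 1/2`. [folklore] -/
theorem clamp_of_le_half {s : ℝ} (hs : s ≤ 1 / 2) : clamp s = 1 := by
  rw [clamp, Real.smoothTransition.zero_of_nonpos (by linarith)]; ring

/-- `1/2 ≤ clamp s`. [folklore] -/
theorem half_le_clamp (s : ℝ) : 1 / 2 ≤ clamp s := by
  rcases le_or_gt 1 s with h | h
  · rw [clamp_of_one_le h]; linarith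
  rcases le_or_gt s (1 / 2) with h' | h'
  · rw [clamp_of_le_half h']; norm_num
  · rw [clamp]
    have h1 := Real.smoothTransition.le_one (2 * s - 1)
    nlinarith [Real.smoothTransition.nonneg (2 * s - 1)]

/-- `clamp s ≤ 1` for `s ≤ 1`. [folklore] -/
theorem clamp_le_one {s : ℝ} (hs : s ≤ 1) : clamp s ≤ 1 := by
  rw [clamp]
  have h1 := Real.smoothTransition.le_one (2 * s - 1)
  nlinarith [Real.smoothTransition.nonneg (2 * s - 1)]

/-- `clamp s ≤ max s 1`. [folklore] -/
theorem clamp_le (s : ℝ) : clamp s ≤ max s 1 := by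
  rcases le_or_gt 1 s with h | h
  · rw [clamp_of_one_le h]; exact le_max_left _ _
  · exact (clamp_le_one h.le).trans (le_max_right _ _)

/-- `0 < clamp s`. [folklore] -/
theorem clamp_pos (s : ℝ) : 0 < clamp s := by linarith [half_le_clamp s]

/-! ### The inverse chart `(z, r) ↦ r • ψ⁻¹ z` -/

/-- **The inverse polar–stereographic chart** `(z, r) ↦ r • ψ⁻¹ z : ℝ³ × ℝ → ℝ⁴`. [folklore] -/
def unchart (q : 𝔼 3 × ℝ) : 𝔼 4 := q.2 • KnotsInBall.phi q.1

/-- `unchart` is `C^∞`. [folklore] -/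
theorem contDiff_unchart : ContDiff ℝ ∞ unchart :=
  contDiff_snd.smul (KnotsInBall.contDiff_phi.comp contDiff_fst)

/-- The norm of `unchart (z, r)` is `|r|`. [folklore] -/
theorem norm_unchart (q : 𝔼 3 × ℝ) : ‖unchart q‖ = |q.2| := by
  rw [unchart, norm_smul, KnotsInBall.norm_phi, mul_one, Real.norm_eq_abs]

end LongAnnulusChart

open LongAnnulusChart

namespace Knot

namespace IsConicalConcordance

variable {K K' : Knot} {f : (𝕊 1) × ℝ → 𝔼 4} {δ : ℝ} (h : IsConicalConcordance K K' f δ)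
include h

/-! ### Direction and level of the clamped lift -/

/-- The point of the concordance read at the clamped parameter. [folklore] -/
def rad (_ : IsConicalConcordance K K' f δ) (p : ℝ × ℝ) : 𝔼 4 :=
  StripFrame.annulusLift f (p.1, clamp p.2)

/-- `rad` is `C^∞`. [folklore] -/
theorem contDiff_rad : ContDiff ℝ ∞ h.rad :=
  (StripFrame.contDiff_annulusLift h.isConcordance.1).comp
    (contDiff_fst.prodMk (contDiff_clamp.comp contDiff_snd))

/-- Below `1 + δ` the clamped point is on the lower cone. [folklore] -/
theorem rad_of_le {p : ℝ × ℝ} (hp : p.2 ≤ 1 + δ) : h.rad p = clamp p.2 • K.curve p.1 := by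
  have hc : clamp p.2 ≤ 1 + δ := by
    refine (clamp_le p.2).trans (max_le hp ?_); linarith [h.δ_pos]
  rw [rad, StripFrame.annulusLift_apply, h.cone₁ _ _ hc, Knot.curve_apply]

/-- From level `1` on, the clamped point is the point of the lift. [folklore] -/
theorem rad_of_one_le {p : ℝ × ℝ} (hp : 1 ≤ p.2) : h.rad p = StripFrame.annulusLift f p := by
  rw [rad, clamp_of_one_le hp]

/-- Above `2 - δ` the clamped point is on the upper cone. [folklore] -/
theorem rad_of_ge {p : ℝ × ℝ} (hp : 2 - δ ≤ p.2) : h.rad p = p.2 • K'.curve p.1 := by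
  rw [h.rad_of_one_le (by linarith [h.δ_le]), StripFrame.annulusLift_apply, h.cone₂ _ _ hp,
    Knot.curve_apply]

/-- `‖rad p‖ ≥ 1/2`. [folklore] -/
theorem half_le_norm_rad (p : ℝ × ℝ) : 1 / 2 ≤ ‖h.rad p‖ := by
  have hδ := h.δ_pos
  have hδ4 := h.δ_le
  rcases le_or_gt p.2 (1 + δ) with h1 | h1
  · rw [h.rad_of_le h1, norm_smul, K.norm_curve, mul_one, Real.norm_eq_abs,
      abs_of_pos (clamp_pos _)]
    exact half_le_clamp _
  · rw [h.rad_of_one_le (by linarith)]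
    rcases lt_or_ge p.2 2 with h2 | h2
    · have := (h.isConcordance.2.2.2.1 (circlePt p.1) p.2 ⟨by linarith, h2⟩).1
      rw [StripFrame.annulusLift_apply]; linarith
    · rw [StripFrame.annulusLift_apply, h.cone₂ _ _ (by linarith), norm_smul, norm_eq_of_mem_sphere,
        mul_one, Real.norm_eq_abs, abs_of_pos (by linarith)]
      linarith

/-- `rad p ≠ 0`. [folklore] -/
theorem rad_ne_zero (p : ℝ × ℝ) : h.rad p ≠ 0 := by
  intro h0; have := h.half_le_norm_rad p; rw [h0, norm_zero] at this; linarith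

/-- The **direction** `rad p / ‖rad p‖`. [folklore] -/
def dir (p : ℝ × ℝ) : 𝔼 4 := ‖h.rad p‖⁻¹ • h.rad p

/-- The direction is a unit vector. [folklore] -/
theorem norm_dir (p : ℝ × ℝ) : ‖h.dir p‖ = 1 := by
  rw [dir, norm_smul, norm_inv, norm_norm, inv_mul_cancel₀ (norm_ne_zero_iff.2 (h.rad_ne_zero p))]

/-- `dir` is `C^∞`. [folklore] -/
theorem contDiff_dir : ContDiff ℝ ∞ h.dir :=
  (ContDiff.inv (h.contDiff_rad.norm ℝ fun p ↦ h.rad_ne_zero p)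
    fun p ↦ norm_ne_zero_iff.2 (h.rad_ne_zero p)).smul h.contDiff_rad

/-- The direction lands in the unit sphere. [folklore] -/
theorem mem_sphere_dir (p : ℝ × ℝ) : h.dir p ∈ sphere (0 : 𝔼 4) 1 := by simp [h.norm_dir p]

/-- The direction as a point of `𝕊³`. [folklore] -/
def dirS : ℝ × ℝ → 𝕊 3 := Set.codRestrict h.dir _ h.mem_sphere_dir

/-- Values of `dirS`. [folklore] -/
@[simp] theorem coe_dirS (p : ℝ × ℝ) : ((h.dirS p : 𝕊 3) : 𝔼 4) = h.dir p := rfl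

/-- `dirS` is smooth. [folklore] -/
theorem contMDiff_dirS : ContMDiff 𝓘(ℝ, ℝ × ℝ) (𝓡 3) ∞ h.dirS :=
  h.contDiff_dir.contMDiff.codRestrict_sphere _

/-- Below `1 + δ` the direction is the lower end knot. [folklore] -/
theorem dirS_of_le {p : ℝ × ℝ} (hp : p.2 ≤ 1 + δ) : h.dirS p = K (circlePt p.1) := by
  apply Subtype.ext
  rw [coe_dirS, dir, h.rad_of_le hp, norm_smul, K.norm_curve, mul_one, Real.norm_eq_abs,
    abs_of_pos (clamp_pos _), smul_smul, inv_mul_cancel₀ (clamp_pos _).ne', one_smul, Knot.curve_apply]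

/-- Above `2 - δ` the direction is the upper end knot. [folklore] -/
theorem dirS_of_ge {p : ℝ × ℝ} (hp : 2 - δ ≤ p.2) : h.dirS p = K' (circlePt p.1) := by
  have hp0 : 0 < p.2 := by linarith [h.δ_le]
  apply Subtype.ext
  rw [coe_dirS, dir, h.rad_of_ge hp, norm_smul, K'.norm_curve, mul_one, Real.norm_eq_abs,
    abs_of_pos hp0, smul_smul, inv_mul_cancel₀ hp0.ne', one_smul, Knot.curve_apply]

/-- On `[1, 2]` the direction is the normalised point of the lift. [folklore] -/
theorem coe_dirS_of_mem {p : ℝ × ℝ} (hp : 1 ≤ p.2) :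
    ((h.dirS p : 𝕊 3) : 𝔼 4) = ‖StripFrame.annulusLift f p‖⁻¹ • StripFrame.annulusLift f p := by
  rw [coe_dirS, dir, h.rad_of_one_le hp]

/-- The **level**: `s` below level `1`, `‖f‖` above. [folklore] -/
def lev (p : ℝ × ℝ) : ℝ := ‖h.rad p‖ + (p.2 - clamp p.2)

/-- `lev` is `C^∞`. [folklore] -/
theorem contDiff_lev : ContDiff ℝ ∞ h.lev :=
  (h.contDiff_rad.norm ℝ fun p ↦ h.rad_ne_zero p).add (contDiff_snd.sub (contDiff_clamp.comp contDiff_snd))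

/-- Below `1 + δ` the level is the parameter. [folklore] -/
theorem lev_of_le {p : ℝ × ℝ} (hp : p.2 ≤ 1 + δ) : h.lev p = p.2 := by
  rw [lev, h.rad_of_le hp, norm_smul, K.norm_curve, mul_one, Real.norm_eq_abs, abs_of_pos (clamp_pos _)]
  ring

/-- From level `1` on, the level is the norm of the lift. [folklore] -/
theorem lev_of_one_le {p : ℝ × ℝ} (hp : 1 ≤ p.2) : h.lev p = ‖StripFrame.annulusLift f p‖ := by
  rw [lev, h.rad_of_one_le hp, clamp_of_one_le hp, sub_self, add_zero]

/-- Above `2 - δ` the level is the parameter. [folklore] -/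
theorem lev_of_ge {p : ℝ × ℝ} (hp : 2 - δ ≤ p.2) : h.lev p = p.2 := by
  rw [h.lev_of_one_le (by linarith [h.δ_le]), StripFrame.annulusLift_apply, h.cone₂ _ _ hp, norm_smul,
    norm_eq_of_mem_sphere, mul_one, Real.norm_eq_abs, abs_of_pos (by linarith [h.δ_le])]

/-- **`lev • dir` is the lift**, at every parameter. [folklore] -/
theorem lev_smul_dir (p : ℝ × ℝ) : h.lev p • h.dir p = StripFrame.annulusLift f p := by
  rcases le_or_gt p.2 (1 + δ) with h1 | h1
  · obtain ⟨θ, s⟩ := p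
    rw [h.lev_of_le h1, dir, h.rad_of_le h1, norm_smul, K.norm_curve, mul_one, Real.norm_eq_abs,
      abs_of_pos (clamp_pos _), smul_smul, smul_smul, inv_mul_cancel_right₀ (clamp_pos _).ne',
      StripFrame.annulusLift_apply, h.cone₁ _ _ h1, Knot.curve_apply]
  · have hp : 1 ≤ p.2 := by linarith [h.δ_pos]
    rw [h.lev_of_one_le hp, dir, h.rad_of_one_le hp, smul_smul,
      mul_inv_cancel₀ (by rw [← h.rad_of_one_le hp]; exact norm_ne_zero_iff.2 (h.rad_ne_zero p)), one_smul]

/-- In the middle the level is in the open shell. [folklore] -/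
theorem lev_mem_Ioo {p : ℝ × ℝ} (hp : p.2 ∈ Ioo (1 : ℝ) 2) : h.lev p ∈ Ioo (1 : ℝ) 2 := by
  rw [h.lev_of_one_le hp.1.le, StripFrame.annulusLift_apply]
  exact h.isConcordance.2.2.2.1 _ _ hp

/-! ### The chart -/

/-- **The polar–stereographic chart of the concordance**: `(ψ (direction), level)`. [folklore] -/
def chartF (p : ℝ × ℝ) : 𝔼 3 × ℝ := (KnotsInBall.psi (h.dirS p), h.lev p)

/-- The pole condition: all directions miss the south pole, given that the end knots and the
middle directions do. [folklore] -/
theorem dirS_ne_southPole (hK : ∀ x, K x ≠ KnotsInBall.southPole) (hK' : ∀ x, K' x ≠ KnotsInBall.southPole)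
    (hmid : ∀ θ, ∀ t ∈ Icc (1 : ℝ) 2,
      ‖StripFrame.annulusLift f (θ, t)‖⁻¹ • StripFrame.annulusLift f (θ, t) ≠
        ((KnotsInBall.southPole : 𝕊 3) : 𝔼 4))
    (p : ℝ × ℝ) : h.dirS p ≠ KnotsInBall.southPole := by
  rcases le_or_gt p.2 (1 + δ) with h1 | h1
  · rw [h.dirS_of_le h1]; exact hK _
  rcases le_or_gt (2 - δ) p.2 with h2 | h2
  · rw [h.dirS_of_ge h2]; exact hK' _
  · intro heq
    obtain ⟨θ, s⟩ := p
    have hp : s ∈ Icc (1 : ℝ) 2 := ⟨by simp only at h1; linarith [h.δ_pos], by simp only at h2; linarith [h.δ_pos]⟩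
    apply hmid θ s hp
    rw [← h.coe_dirS_of_mem (p := (θ, s)) hp.1, heq]

variable (hpole : ∀ p, h.dirS p ≠ KnotsInBall.southPole)
include hpole

/-- The chart is `C^∞`. [folklore] -/
theorem contDiff_chartF : ContDiff ℝ ∞ h.chartF := by
  have h1 : ContMDiff 𝓘(ℝ, ℝ × ℝ) (𝓡 3) ∞ fun p ↦ KnotsInBall.psi (h.dirS p) :=
    KnotsInBall.contMDiffOn_psi.comp_contMDiff h.contMDiff_dirS fun p ↦
      KnotsInBall.mem_psi_source (hpole p)
  have h2 : ContDiff ℝ ∞ fun p ↦ KnotsInBall.psi (h.dirS p) := by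
    rw [← contMDiff_iff_contDiff]; exact h1
  exact h2.prodMk h.contDiff_lev

/-- **`unchart ∘ chartF` is the lift.** [folklore] -/
theorem unchart_chartF (p : ℝ × ℝ) : unchart (h.chartF p) = StripFrame.annulusLift f p := by
  rw [chartF, unchart]
  simp only [KnotsInBall.phi, KnotsInBall.psi_symm_apply_psi (hpole p), coe_dirS]
  exact h.lev_smul_dir p

omit hpole in
/-- The chart is `1`-periodic in `θ`. [folklore] -/
theorem chartF_add_one (θ s : ℝ) : h.chartF (θ + 1, s) = h.chartF (θ, s) := by
  have hr : h.rad (θ + 1, s) = h.rad (θ, s) := by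
    simp only [rad]
    have := StripFrame.annulusLift_add_int f θ (clamp s) 1
    push_cast at this
    exact this
  have hd : h.dirS (θ + 1, s) = h.dirS (θ, s) := by
    apply Subtype.ext; simp only [coe_dirS, dir, hr]
  have hl : h.lev (θ + 1, s) = h.lev (θ, s) := by simp only [lev, hr]
  rw [chartF, chartF, hd, hl]

/-- The chart has injective differential on the thickened annulus. [folklore] -/
theorem injective_fderiv_chartF {p : ℝ × ℝ} (hp : p.2 ∈ Icc (1 - δ / 2) (2 + δ / 2)) :
    Injective (fderiv ℝ h.chartF p) := by
  have hcomp : fderiv ℝ (StripFrame.annulusLift f) p =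
      (fderiv ℝ unchart (h.chartF p)).comp (fderiv ℝ h.chartF p) := by
    have he : StripFrame.annulusLift f = unchart ∘ h.chartF := funext fun q ↦ (h.unchart_chartF hpole q).symm
    rw [he]
    exact fderiv_comp p ((contDiff_unchart.differentiable (by simp)) _)
      (((h.contDiff_chartF hpole).differentiable (by simp)) p)
  have hinj := h.injective_fderiv_annulusLift p.1 hp
  rw [show (p.1, p.2) = p from rfl, hcomp] at hinj
  exact Injective.of_comp hinj

/-- The chart identifies exactly the integer translates over `[1, 2]`. [folklore] -/
theorem eq_of_chartF_eq {p q : ℝ × ℝ} (hp : p.2 ∈ Icc (1 : ℝ) 2) (hq : q.2 ∈ Icc (1 : ℝ) 2)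
    (he : h.chartF p = h.chartF q) : p.2 = q.2 ∧ ∃ m : ℤ, q.1 = p.1 + m := by
  have he' : StripFrame.annulusLift f p = StripFrame.annulusLift f q := by
    rw [← h.unchart_chartF hpole p, ← h.unchart_chartF hpole q, he]
  exact h.exists_int_of_F_eq hp hq he'

/-! ### The long annulus -/

omit hpole in
/-- **The margin of the middle levels**: on `[1 + δ, 2 - δ]` the level stays in `[1 + m, 2 - m]`
for some `m > 0` (compactness). [folklore] -/
theorem exists_margin : ∃ m : ℝ, 0 < m ∧ ∀ θ, ∀ s ∈ Icc (1 + δ) (2 - δ),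
    h.lev (θ, s) ∈ Icc (1 + m) (2 - m) := by
  have hδ := h.δ_pos
  have hδ4 := h.δ_le
  have hKc : IsCompact (Icc (0 : ℝ) 1 ×ˢ Icc (1 + δ) (2 - δ)) := isCompact_Icc.prod isCompact_Icc
  have hne : (Icc (0 : ℝ) 1 ×ˢ Icc (1 + δ) (2 - δ)).Nonempty :=
    ⟨(0, 3 / 2), ⟨⟨le_rfl, zero_le_one⟩, ⟨by linarith, by linarith⟩⟩⟩
  have hc₁ : Continuous fun p : ℝ × ℝ ↦ h.lev p - 1 := h.contDiff_lev.continuous.sub continuous_const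
  have hc₂ : Continuous fun p : ℝ × ℝ ↦ 2 - h.lev p := continuous_const.sub h.contDiff_lev.continuous
  obtain ⟨p₁, hp₁, hmin₁⟩ := hKc.exists_isMinOn hne hc₁.continuousOn
  obtain ⟨p₂, hp₂, hmin₂⟩ := hKc.exists_isMinOn hne hc₂.continuousOn
  rw [isMinOn_iff] at hmin₁ hmin₂
  have hmem : ∀ p ∈ Icc (0 : ℝ) 1 ×ˢ Icc (1 + δ) (2 - δ), h.lev p ∈ Ioo (1 : ℝ) 2 := fun p hp ↦
    h.lev_mem_Ioo ⟨by linarith [(mem_prod.1 hp).2.1], by linarith [(mem_prod.1 hp).2.2]⟩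
  have h1 : 0 < h.lev p₁ - 1 := by linarith [(hmem p₁ hp₁).1]
  have h2 : 0 < 2 - h.lev p₂ := by linarith [(hmem p₂ hp₂).2]
  refine ⟨min (h.lev p₁ - 1) (2 - h.lev p₂), lt_min h1 h2, fun θ s hs ↦ ?_⟩
  -- reduce `θ` to `[0, 1)`
  set θ' : ℝ := Int.fract θ with hθ'
  have hper : h.lev (θ, s) = h.lev (θ', s) := by
    have hr : h.rad (θ, s) = h.rad (θ', s) := by
      simp only [rad]
      have := StripFrame.annulusLift_add_int f θ' (clamp s) ⌊θ⌋
      rw [show θ' + (⌊θ⌋ : ℝ) = θ from Int.fract_add_floor θ] at this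
      exact this
    simp only [lev, hr]
  have hθ'mem : (θ', s) ∈ Icc (0 : ℝ) 1 ×ˢ Icc (1 + δ) (2 - δ) :=
    ⟨⟨Int.fract_nonneg θ, (Int.fract_lt_one θ).le⟩, hs⟩
  rw [hper]
  constructor
  · have := hmin₁ _ hθ'mem; linarith [min_le_left (h.lev p₁ - 1) (2 - h.lev p₂)]
  · have := hmin₂ _ hθ'mem; linarith [min_le_right (h.lev p₁ - 1) (2 - h.lev p₂)]

/-- **The chart of a conical concordance is a long annulus.** If the end knots and the middle
directions of a conical concordance `f` from `K` to `K'` miss the south pole, then for some width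
`0 < η ≤ δ` its polar–stereographic chart is a long annulus of `ℝ³ × ℝ` with end curves
`ψ ∘ K ∘ circlePt`, `ψ ∘ K' ∘ circlePt`, read back to `f` by `(z, r) ↦ r • ψ⁻¹ z`. [folklore] -/
theorem exists_longAnnulus :
    ∃ (η : ℝ) (A : LongAnnulus η), η ≤ δ ∧ (A.k₁ = fun θ ↦ KnotsInBall.psi (K (circlePt θ))) ∧
      (A.k₂ = fun θ ↦ KnotsInBall.psi (K' (circlePt θ))) ∧ A.F = h.chartF ∧
      ∀ p, unchart (A.F p) = StripFrame.annulusLift f p := by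
  have hδ := h.δ_pos
  have hδ4 := h.δ_le
  obtain ⟨m, hm, hmarg⟩ := h.exists_margin
  set η : ℝ := min δ (m / 2) with hη
  have hηpos : 0 < η := lt_min hδ (by positivity)
  have hηδ : η ≤ δ := min_le_left _ _
  have hηm : η ≤ m / 2 := min_le_right _ _
  -- levels: the three regimes
  have hlev : ∀ η' ∈ Icc 0 η, ∀ θ, ∀ s ∈ Icc (1 + η') (2 - η'), h.lev (θ, s) ∈ Icc (1 + η') (2 - η') := by
    intro η' hη' θ s hs
    rcases le_or_gt s (1 + δ) with h1 | h1
    · rw [h.lev_of_le (p := (θ, s)) h1]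
      exact ⟨hs.1, hs.2⟩
    rcases le_or_gt (2 - δ) s with h2 | h2
    · rw [h.lev_of_ge (p := (θ, s)) h2]
      exact ⟨hs.1, hs.2⟩
    · have := hmarg θ s ⟨h1.le, h2.le⟩
      exact ⟨by linarith [this.1, hη'.2], by linarith [this.2, hη'.2]⟩
  have hlev' : ∀ η' ∈ Icc 0 η, ∀ θ, ∀ s ∈ Ioo (1 + η') (2 - η'), h.lev (θ, s) ∈ Ioo (1 + η') (2 - η') := by
    intro η' hη' θ s hs
    rcases le_or_gt s (1 + δ) with h1 | h1
    · rw [h.lev_of_le (p := (θ, s)) h1]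
      exact ⟨hs.1, hs.2⟩
    rcases le_or_gt (2 - δ) s with h2 | h2
    · rw [h.lev_of_ge (p := (θ, s)) h2]
      exact ⟨hs.1, hs.2⟩
    · have := hmarg θ s ⟨h1.le, h2.le⟩
      exact ⟨by linarith [this.1, hη'.2], by linarith [this.2, hη'.2]⟩
  refine ⟨η,
    { F := h.chartF
      k₁ := fun θ ↦ KnotsInBall.psi (K (circlePt θ))
      k₂ := fun θ ↦ KnotsInBall.psi (K' (circlePt θ))
      contDiff_F := h.contDiff_chartF hpole
      η_pos := hηpos
      η_le := hηδ.trans hδ4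
      F_add_one := h.chartF_add_one
      collar₁ := fun θ s hs ↦ ?_
      collar₂ := fun θ s hs ↦ ?_
      margin := fun η' hη' θ s hs ↦ hlev η' hη' θ s hs
      margin_Ioo := fun η' hη' θ s hs ↦ hlev' η' hη' θ s hs
      inj := fun p q hp hq he ↦ h.eq_of_chartF_eq hpole hp hq he
      injective_fderiv := fun p hp ↦ h.injective_fderiv_chartF hpole
        ⟨by linarith [hp.1], by linarith [hp.2]⟩ }, hηδ, rfl, rfl, rfl, fun p ↦ h.unchart_chartF hpole p⟩
  · show (KnotsInBall.psi (h.dirS (θ, s)), h.lev (θ, s)) = _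
    rw [h.dirS_of_le (p := (θ, s)) (by linarith), h.lev_of_le (p := (θ, s)) (by linarith)]
  · show (KnotsInBall.psi (h.dirS (θ, s)), h.lev (θ, s)) = _
    rw [h.dirS_of_ge (p := (θ, s)) (by simp only; linarith), h.lev_of_ge (p := (θ, s)) (by simp only; linarith)]

end IsConicalConcordance

end Knot

end Literature.Topology.FourManifolds
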